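import Literature.NumberTheory.DiophantineApproximation.NesterenkoCriterionTwoRates
import Summits.KontsevichZagierPeriods.Zeta5Search.CriteriaNesterenko
import HarnessLib

/-!
# ζ(5) search — criterion C2 with decay BRACKETS instead of an exact limit (cell `pub-zeta5`, TYPER)

HONEST FRAMING: systematic search; no irrationality claim unless certified.

`CriteriaNesterenko.lean` (criterion C2 of `CRITERIA.md`) needs the EXACT rate
`|L_n|^{1/n} → e^{-σ}` of the integer forms — for a recurrence-generated family this is a
Poincaré–Perron statement, which the cell's finitary tools (ratio inductions,
`RecurrenceGrowth*.lean`) do not deliver: they deliver BRACKETS `e^{-σ₁ n} ≤ |L_n| ≤ e^{-σ₂ n}`.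
Nesterenko's criterion in its ORIGINAL two-exponent form (1985, Theorem 1; tree:
`Literature.NumberTheory.DiophantineApproximation.NesterenkoCriterion.nesterenko_criterion_two_rates`,
PROVED) works with brackets, at the price of the gap `σ₁ - σ₂` in the margin. This file is its
cell-side corollary, all PROVED:

* `linearIndependent_of_nesterenko_brackets` — full `ℚ`-linear independence of `θ` when
  `card ι - 1 < (log β - log α₁)/(log β + log α₂ - log α₁)`;
* `irrational_of_nesterenko_brackets_margin` — exponent form: coefficients `≤ e^{Q' n}`
  (all `Q' > Q`), `|L_n| ≤ e^{-s n}` eventually for every `s < σ₂`, `e^{-s n} ≤ |L_n|` eventually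
  for every `s > σ₁` (`0 < σ₂ ≤ σ₁`), and the BRACKET MARGIN
  `(card ι - 2)(Q + σ₁) < (card ι - 1) σ₂` ⇒ independence and irrationality of every `θ j ≠ θ j₁ = 1`;
* `zetaFive_of_threeTermForms_brackets` — `θ = (1, ζ(3), ζ(5))`: margin `Q + σ₁ < 2 σ₂`, i.e.
  `μ₂' := σ₂ - Q - (σ₁ - σ₂) > 0` (for `σ₁ = σ₂ = σ` this is C2's `μ₂ = σ - Q > 0`), gives
  `LinearIndependent ℚ ![1, ζ(3), ζ(5)]` and `ZetaFiveIrrational`. Implication only.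
-/

noncomputable section

open Filter Topology Finset Module
open Literature.NumberTheory.Transcendental
open Literature.NumberTheory.DiophantineApproximation

namespace Summit.KontsevichZagierPeriods.Zeta5Search

/-- **Full linear independence from Nesterenko's two-exponent criterion.** Integer forms
`ℓ_n = ∑ j, p n j θ j` with `|p n j| ≤ β'^n` eventually for every `β' > β` (`β > 1`),
`|ℓ_n| < aⁿ` eventually for every `a > α₂`, `aⁿ < |ℓ_n|` eventually for every `0 ≤ a < α₁`
(`0 < α₁ ≤ α₂ < 1`): if `card ι - 1 < (log β - log α₁)/(log β + log α₂ - log α₁)` then `θ` is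
linearly independent over `ℚ`. -/
theorem linearIndependent_of_nesterenko_brackets {ι : Type*} [Fintype ι] (θ : ι → ℝ)
    (p : ℕ → ι → ℤ) {α₁ α₂ β : ℝ} (hα₁ : 0 < α₁) (hα₁₂ : α₁ ≤ α₂) (hα₂1 : α₂ < 1) (hβ : 1 < β)
    (hp : ∀ β' : ℝ, β < β' → ∀ᶠ n : ℕ in atTop, ∀ j, |(p n j : ℝ)| ≤ β' ^ n)
    (hup : ∀ a : ℝ, α₂ < a → ∀ᶠ n : ℕ in atTop, |∑ j, (p n j : ℝ) * θ j| < a ^ n)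
    (hlow : ∀ a : ℝ, 0 ≤ a → a < α₁ → ∀ᶠ n : ℕ in atTop, a ^ n < |∑ j, (p n j : ℝ) * θ j|)
    (hfull : (Fintype.card ι : ℝ) - 1 <
      (Real.log β - Real.log α₁) / (Real.log β + Real.log α₂ - Real.log α₁)) :
    LinearIndependent ℚ θ := by
  have h1 := NesterenkoCriterion.nesterenko_criterion_two_rates θ p hα₁ hα₁₂ hα₂1 hβ hp hup hlow
  have h2 : (Set.range θ).finrank ℚ ≤ Fintype.card ι := finrank_range_le_card θ
  have h3 : (Fintype.card ι : ℝ) - 1 < ((Set.range θ).finrank ℚ : ℝ) := hfull.trans_le h1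
  have h4 : Fintype.card ι < (Set.range θ).finrank ℚ + 1 := by
    have h5 : ((Fintype.card ι : ℕ) : ℝ) < ((Set.range θ).finrank ℚ : ℝ) + 1 := by linarith
    exact_mod_cast h5
  exact linearIndependent_iff_card_eq_finrank_span.2 (by omega)

/-- **C2 with brackets, exponent/margin form.** Let `θ : ι → ℝ` with `θ j₁ = 1` and integer forms
`ℓ_n = ∑ j, p n j θ j` with coefficients `|p n j| ≤ e^{Q' n}` eventually for every `Q' > Q`
(`Q > 0`), upper decay bracket `|ℓ_n| ≤ e^{-s n}` eventually for every `s < σ₂` and lower bracket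
`e^{-s n} ≤ |ℓ_n|` eventually for every `s > σ₁`, where `0 < σ₂ ≤ σ₁`. If the bracket margin
`(card ι - 2)(Q + σ₁) < (card ι - 1) σ₂` holds, then `θ` is `ℚ`-linearly independent and every
`θ j` (`j ≠ j₁`) is irrational. -/
theorem irrational_of_nesterenko_brackets_margin {ι : Type*} [Fintype ι] (θ : ι → ℝ) (j₁ : ι)
    (h1 : θ j₁ = 1) (p : ℕ → ι → ℤ) {σ₁ σ₂ Q : ℝ} (hσ₂ : 0 < σ₂) (hσ₁₂ : σ₂ ≤ σ₁) (hQ : 0 < Q)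
    (hp : ∀ Q' : ℝ, Q < Q' → ∀ᶠ n : ℕ in atTop, ∀ j, |(p n j : ℝ)| ≤ Real.exp (Q' * n))
    (hup : ∀ s : ℝ, s < σ₂ → ∀ᶠ n : ℕ in atTop, |∑ j, (p n j : ℝ) * θ j| ≤ Real.exp (-(s * n)))
    (hlow : ∀ s : ℝ, σ₁ < s → ∀ᶠ n : ℕ in atTop, Real.exp (-(s * n)) ≤ |∑ j, (p n j : ℝ) * θ j|)
    (hmargin : ((Fintype.card ι : ℝ) - 2) * (Q + σ₁) < ((Fintype.card ι : ℝ) - 1) * σ₂) :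
    LinearIndependent ℚ θ ∧ ∀ j, j ≠ j₁ → Irrational (θ j) := by
  set α₁ : ℝ := Real.exp (-σ₁) with hα₁def
  set α₂ : ℝ := Real.exp (-σ₂) with hα₂def
  set β : ℝ := Real.exp Q with hβdef
  have hα₁ : 0 < α₁ := Real.exp_pos _
  have hα₁₂ : α₁ ≤ α₂ := Real.exp_le_exp.2 (by linarith)
  have hα₂1 : α₂ < 1 := Real.exp_lt_one_iff.2 (by linarith)
  have hβ : 1 < β := Real.one_lt_exp_iff.2 hQ
  -- coefficients
  have hp' : ∀ β' : ℝ, β < β' → ∀ᶠ n : ℕ in atTop, ∀ j, |(p n j : ℝ)| ≤ β' ^ n := by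
    intro β' hβ'
    have hβ'0 : 0 < β' := (Real.exp_pos Q).trans hβ'
    have hQ' : Q < Real.log β' := by rw [Real.lt_log_iff_exp_lt hβ'0]; exact hβ'
    filter_upwards [hp (Real.log β') hQ'] with n hn j
    have e : Real.exp (Real.log β' * n) = β' ^ n := by
      rw [mul_comm, Real.exp_nat_mul, Real.exp_log hβ'0]
    rw [← e]; exact hn j
  -- upper bracket: for `a > α₂` pick `s` with `-log a < s < σ₂`
  have hup' : ∀ a : ℝ, α₂ < a → ∀ᶠ n : ℕ in atTop, |∑ j, (p n j : ℝ) * θ j| < a ^ n := by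
    intro a ha
    have ha0 : 0 < a := (Real.exp_pos _).trans ha
    have hlog : -Real.log a < σ₂ := by
      have := Real.log_lt_log (Real.exp_pos _) ha
      rw [Real.log_exp] at this; linarith
    obtain ⟨s, hs1, hs2⟩ := exists_between hlog
    filter_upwards [hup s hs2, eventually_ge_atTop 1] with n hn hn1
    refine hn.trans_lt ?_
    have e : a ^ n = Real.exp (Real.log a * n) := by
      rw [mul_comm, Real.exp_nat_mul, Real.exp_log ha0]
    rw [e, Real.exp_lt_exp]
    have hn1' : (1 : ℝ) ≤ n := by exact_mod_cast hn1
    nlinarith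
  -- lower bracket: for `0 ≤ a < α₁` pick `s` with `σ₁ < s < -log a` (or any `s > σ₁` if `a = 0`)
  have hlow' : ∀ a : ℝ, 0 ≤ a → a < α₁ →
      ∀ᶠ n : ℕ in atTop, a ^ n < |∑ j, (p n j : ℝ) * θ j| := by
    intro a ha0 ha
    rcases ha0.eq_or_lt with rfl | ha0'
    · filter_upwards [hlow (σ₁ + 1) (by linarith), eventually_ge_atTop 1] with n hn hn1
      rw [zero_pow (by omega)]
      exact (Real.exp_pos _).trans_le hn
    · have hlog : σ₁ < -Real.log a := by
        have := Real.log_lt_log ha0' ha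
        rw [Real.log_exp] at this; linarith
      obtain ⟨s, hs1, hs2⟩ := exists_between hlog
      filter_upwards [hlow s hs1, eventually_ge_atTop 1] with n hn hn1
      refine lt_of_lt_of_le ?_ hn
      have e : a ^ n = Real.exp (Real.log a * n) := by
        rw [mul_comm, Real.exp_nat_mul, Real.exp_log ha0']
      rw [e, Real.exp_lt_exp]
      have hn1' : (1 : ℝ) ≤ n := by exact_mod_cast hn1
      nlinarith
  -- the dimension condition
  have hfull : (Fintype.card ι : ℝ) - 1 <
      (Real.log β - Real.log α₁) / (Real.log β + Real.log α₂ - Real.log α₁) := by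
    simp only [hα₁def, hα₂def, hβdef, Real.log_exp]
    have hden : 0 < Q + -σ₂ - -σ₁ := by linarith
    rw [lt_div_iff₀ hden]
    nlinarith
  have hli := linearIndependent_of_nesterenko_brackets θ p hα₁ hα₁₂ hα₂1 hβ hp' hup' hlow' hfull
  exact ⟨hli, fun j hj => irrational_of_linearIndependent θ hli hj h1⟩

/-- **Three-term forms in `1, ζ(3), ζ(5)` with decay brackets.** Integer forms
`p n 0 + p n 1 ζ(3) + p n 2 ζ(5)` with coefficients `≤ e^{Q' n}` (all `Q' > Q > 0`), `|L_n| ≤ e^{-s n}`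
eventually for all `s < σ₂`, `e^{-s n} ≤ |L_n|` eventually for all `s > σ₁` (`0 < σ₂ ≤ σ₁`), and
the bracket margin `Q + σ₁ < 2 σ₂` prove `LinearIndependent ℚ ![1, ζ(3), ζ(5)]` and the tree's
open statement `ZetaFiveIrrational`. (Implication only; no such forms are known.) -/
theorem zetaFive_of_threeTermForms_brackets (p : ℕ → Fin 3 → ℤ) {σ₁ σ₂ Q : ℝ} (hσ₂ : 0 < σ₂)
    (hσ₁₂ : σ₂ ≤ σ₁) (hQ : 0 < Q)
    (hp : ∀ Q' : ℝ, Q < Q' → ∀ᶠ n : ℕ in atTop, ∀ j, |(p n j : ℝ)| ≤ Real.exp (Q' * n))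
    (hup : ∀ s : ℝ, s < σ₂ → ∀ᶠ n : ℕ in atTop,
      |(p n 0 : ℝ) + p n 1 * zetaValue 3 + p n 2 * zetaValue 5| ≤ Real.exp (-(s * n)))
    (hlow : ∀ s : ℝ, σ₁ < s → ∀ᶠ n : ℕ in atTop,
      Real.exp (-(s * n)) ≤ |(p n 0 : ℝ) + p n 1 * zetaValue 3 + p n 2 * zetaValue 5|)
    (hmargin : Q + σ₁ < 2 * σ₂) :
    LinearIndependent ℚ ![(1 : ℝ), zetaValue 3, zetaValue 5] ∧ ZetaFiveIrrational := by
  set θ : Fin 3 → ℝ := ![(1 : ℝ), zetaValue 3, zetaValue 5] with hθ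
  have hsum : ∀ n : ℕ, ∑ j, (p n j : ℝ) * θ j =
      (p n 0 : ℝ) + p n 1 * zetaValue 3 + p n 2 * zetaValue 5 := by
    intro n; simp [hθ, Fin.sum_univ_three]
  have hup' : ∀ s : ℝ, s < σ₂ → ∀ᶠ n : ℕ in atTop, |∑ j, (p n j : ℝ) * θ j| ≤ Real.exp (-(s * n)) :=
    fun s hs => (hup s hs).mono fun n hn => by rwa [hsum n]
  have hlow' : ∀ s : ℝ, σ₁ < s → ∀ᶠ n : ℕ in atTop,
      Real.exp (-(s * n)) ≤ |∑ j, (p n j : ℝ) * θ j| :=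
    fun s hs => (hlow s hs).mono fun n hn => by rwa [hsum n]
  have hm : ((Fintype.card (Fin 3) : ℝ) - 2) * (Q + σ₁) < ((Fintype.card (Fin 3) : ℝ) - 1) * σ₂ := by
    simp only [Fintype.card_fin, Nat.cast_ofNat]
    linarith
  obtain ⟨hli, hirr⟩ :=
    irrational_of_nesterenko_brackets_margin θ 0 (by simp [hθ]) p hσ₂ hσ₁₂ hQ hp hup' hlow' hm
  refine ⟨hli, ?_⟩
  have h := hirr 2 (by decide)
  show Irrational (zetaValue 5)
  simpa [hθ] using h

end Summit.KontsevichZagierPeriods.Zeta5Search
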